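/-
Copyright (c) 2026 the pub-hodgecm-mathlib formalisation cell (harness21).  Prover seat hodgecm-mathlib-A-p12 (g25): road «S3-ram» (LEAD F0P3a-plan (g13); (Cnt2′) chair
F0P3a-p07 (g15) RULING (13) organ (4b); (α) keeper F0P3a-p06 (g16)); organ (K4a) of the (4b) decomposition, PART 2/3; 2026-09-02.
-/
import Literature.NumberTheory.Rogawski1990.DepthZeroKappaTransferOddLevelEigenlineCongruence      -- ★ PART 1/3 (this seat): eigenline ⟺ congruence, rep-independence, `v_inv_pow_mul_lt_one_iff`
import Literature.NumberTheory.Automorphic.UnitaryLatticeTreeBlockVertexShapeRamified            -- ★ (K3) (F0P3a-p04 (g20), p849067/p849106): block frames, `coe_endoGL_sub_one_eq_endoShape`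
import Literature.NumberTheory.Automorphic.UnitaryLatticeTreeRegionUpClosedOfRootRamified          -- ★ `exists_parent_grandparent_lev_of_root` (F0P2-p02)
import Literature.NumberTheory.Automorphic.UnitaryLatticeTreeRankOneVertexShapeRamified           -- ★ `mapGL_N₁_eq_iff_v_apply_two_zero_lt_one`
import HarnessLib

/-!
# The ramified `κ`-orbital integral, TYPE (2): EIGENLINE CHILDREN OF AN AXIS REGION VERTEX OF A BLOCK LITERAL — parent, block neighbour, shell, inner (organ (4b), part (K4a) 2/3)
# (Kottwitz 1986 §3; Rogawski 1990 §4.8–4.9; Bruhat–Tits 1972 §10)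

Topic `NumberTheory/Rogawski1990`; namespace `Literature.NumberTheory.Rogawski1990.TypeOneRamifiedJunction`.  THEOREMS ONLY (no definition, no instance, no notation, no named
fact, no `sorry`); kernel lane `--supports stmt-HodgeConjecture-24833`; datum-free.  Cell `pub/hodgecm-mathlib` (D-0151), crux H413; road «S3-ram» (count-neutral); (Cnt2′)
ROUTE B, chair RULING (13) organ **(4b)** (A-p12 (g25)), part (K4a) 2/3.  Setting: `γ ∈ K₀`, a region vertex `v = u·r₀` (`LEV[v](ϖ^{d})`) in whose frame the literal is BLOCK,
`↑(u⁻¹γu) = ι(g₁, u′)` (★ (K3) `exists_adaptedBlockFrame`, F0P3a-p04 (g20)), ADAPTED (`|g₁,₁₀| ≤ |ϖ|^{d+1}`) and J-SYMMETRIC (`|(g₁−1)₀₀ − (g₁−1)₁₁| ≤ |ϖ|^{d+1}`).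
* §3 **`eigenline_of_towards_root`**: the neighbour of `v ≠ r₀` TOWARDS the root is an eigenline (it is the parent; its far side holds the grandparent, which keeps the level by ★
  `exists_parent_grandparent_lev_of_root`; then ★ (K1) `map_sub_one_far_le_scaleLattice_iff_eigenline_of_odd`).  Any `γ ∈ K₀` with `LEV[r₀](ϖ^{d₀})`, `d₀` odd.
* §4 **`eigenline_one_of_block`**: the block neighbour `u·N₁` (`κ = 1`) is an eigenline (`M₁₀ = 0`, `M₂₀ = g₁,₁₀`).
* §5 **`latticeGraphIso_eq_of_eigenline_of_shell`**: at a SHELL vertex (`¬ |g₁,₀₁| ≤ |ϖ|^{d+1}`) an eigenline child IS `u·N₁` — the congruence `Mx ≡ cx` with `|x₂| = 1` would force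
  `|g₁,₀₁| ≤ |ϖ|^{d+1}`; so `|κ₂₀| < 1` and ★ `mapGL_N₁_eq_iff_v_apply_two_zero_lt_one`.
* §6 **`eigenline_of_null_of_inner`**: at an INNER vertex (`|g₁,₀₁| ≤ |ϖ|^{d+1}`, `c̄ ≠ 0`) a child with NULL value is an eigenline — `B₀(x, Mx) ≡ (u′₀₀ − g₁,₀₀)·σ(x₁)x₁`
  (`B₀(x,x) = 0`), so null forces `|x₁| < 1` and then `Mx ≡ (g₁−1)₀₀·x (mod ϖ^{d+1})`.
These are the type-(2) facts behind B-p14 (g40)'s KIND law (MEMO v2 (L4)); part 3/3 turns them into the counts.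
HONEST LABEL: HC_CM is proved only modulo the 2 remaining named inputs (hLiu418 24832, h413 24833) until rung 0 closes; nothing printed is asserted here (lattice
bookkeeping over ★ results); «S3-ram» is Literature seeding, count-neutral.

## References
* [Kottwitz1986] R. E. Kottwitz, *Base change for unit elements of Hecke algebras*, Compositio Math. 60 (1986), §3 (counting fixed lattices shell by shell).
* [Rogawski1990] J. D. Rogawski, *Automorphic Representations of Unitary Groups in Three Variables*, Ann. of Math. Stud. 123 (1990), §4.8 Case (a) p. 53, §4.9 pp. 54–56, Prop. 4.9.1 (b).
* [BruhatTits1972] F. Bruhat, J. Tits, *Groupes réductifs sur un corps local I*, Publ. Math. IHÉS 41 (1972), §10 (lattice models of the building).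
* [Tits1979] J. Tits, *Reductive groups over local fields*, PSPM 33.1 (1979), §3.5.
* [Serre1980Trees] J.-P. Serre, *Trees* (1980), Ch. II §1.1.
-/

set_option autoImplicit false

noncomputable section

open scoped Valued WithZero Matrix MatrixGroups
open Polynomial Classical SimpleGraph
open Literature.NumberTheory.Automorphic Literature.NumberTheory.Automorphic.HermitianLattice Literature.NumberTheory.Automorphic.UnitaryLatticeTree
open Literature.Combinatorics.SimpleGraph.TreeLayers

namespace Literature.NumberTheory.Rogawski1990.TypeOneRamifiedJunction

variable {K : Type*} [Field K] [Valued K ℤᵐ⁰] {σ : K →+* K} {ϖ : K}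

/-! ## §3 The parent of a non-root region vertex is an eigenline -/

/-- **THE PARENT LINE IS AN EIGENLINE.**  `γ ∈ K₀` with `LEV[r₀](ϖ^{d₀})`, `d₀` odd; `v = u·r₀ ≠ r₀` a region vertex (self-dual, fixed, `LEV[v](ϖ^{d₀})`); a neighbour
`(uκ)·N₁` of `v` (`κ ∈ K₀`) lying TOWARDS the root (`dist(r₀, (uκ)N₁) + 1 = dist(r₀, v)`) is an eigenline — it is THE parent, its far side holds the grandparent, which keeps the
level (★ `exists_parent_grandparent_lev_of_root`), and ★ (K1) `map_sub_one_far_le_scaleLattice_iff_eigenline_of_odd`. [cite: Kottwitz1986, §3] [cite: BruhatTits1972, §10] -/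
theorem eigenline_of_towards_root (hσ : ∀ x, σ (σ x) = x) (hvσ : ∀ a, Valued.v (σ a) = Valued.v a) (hσϖ : σ ϖ = -ϖ)
    (hϖ : Valued.v ϖ = WithZero.exp (-1 : ℤ)) (hres : ∀ x : K, Valued.v x ≤ 1 → Valued.v (σ x - x) < 1) (h2 : Valued.v (2 : K) = 1)
    (hnorm : ∀ u : K, σ u = u → Valued.v (u - 1) < 1 → ∃ z : K, z * σ z = u ∧ Valued.v (z - 1) ≤ Valued.v (u - 1))
    [ValuativeRel K] [(Valued.v : Valuation K ℤᵐ⁰).Compatible] [Finite 𝓀[K]]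
    (hT : (latticeGraph σ ϖ ((StdForm.antidiagonal 3).over K)).IsTree)
    {γ : unitaryGroupOfForm σ ((StdForm.antidiagonal 3).over K)} (hγ0 : γ ∈ unitaryInt σ ((StdForm.antidiagonal 3).over K)) {d₀ : ℕ} (hodd : Odd d₀)
    (hroot : (stdLattice K 3).map ((Matrix.toLin' (((γ : GL (Fin 3) K) : Matrix (Fin 3) (Fin 3) K) - 1)).restrictScalars 𝒪[K]) ≤ scaleLattice (ϖ ^ d₀) (stdLattice K 3))
    (u : unitaryGroupOfForm σ ((StdForm.antidiagonal 3).over K)) {v : {M : Submodule 𝒪[K] (Fin 3 → K) // IsVertex σ ϖ ((StdForm.antidiagonal 3).over K) M}} (hvu : v = latticeGraphIso σ ϖ ((StdForm.antidiagonal 3).over K) u ⟨stdLattice K 3, 0, isSelfDualLattice_stdLattice_three_of_v hϖ⟩)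
    (hv : IsSelfDualLattice σ ϖ ((StdForm.antidiagonal 3).over K) v.1) (hvr : v ≠ ⟨stdLattice K 3, 0, isSelfDualLattice_stdLattice_three_of_v hϖ⟩)
    (hfix : latticeGraphIso σ ϖ ((StdForm.antidiagonal 3).over K) γ v = v)
    (hvR : v.1.map ((Matrix.toLin' (((γ : GL (Fin 3) K) : Matrix (Fin 3) (Fin 3) K) - 1)).restrictScalars 𝒪[K]) ≤ scaleLattice (ϖ ^ d₀) v.1)
    {κ : unitaryGroupOfForm σ ((StdForm.antidiagonal 3).over K)} (hκ : κ ∈ unitaryInt σ ((StdForm.antidiagonal 3).over K))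
    (htow : (latticeGraph σ ϖ ((StdForm.antidiagonal 3).over K)).dist ⟨stdLattice K 3, 0, isSelfDualLattice_stdLattice_three_of_v hϖ⟩ (latticeGraphIso σ ϖ ((StdForm.antidiagonal 3).over K) (u * κ) ⟨latt (Matrix.diagonal ![(1 : K), 1, ϖ]), 2, isVertexLattice_two_N₁_of_neg hσϖ hϖ⟩) + 1 =
      (latticeGraph σ ϖ ((StdForm.antidiagonal 3).over K)).dist ⟨stdLattice K 3, 0, isSelfDualLattice_stdLattice_three_of_v hϖ⟩ v) :
    (Valued.v (((((((u * κ : unitaryGroupOfForm σ ((StdForm.antidiagonal 3).over K)) : GL (Fin 3) K))⁻¹ : GL (Fin 3) K) : Matrix (Fin 3) (Fin 3) K) * (((γ : GL (Fin 3) K) : Matrix (Fin 3) (Fin 3) K) - 1) * (((u * κ : unitaryGroupOfForm σ ((StdForm.antidiagonal 3).over K)) : GL (Fin 3) K) : Matrix (Fin 3) (Fin 3) K)) 1 0) ≤ Valued.v ϖ ^ (d₀ + 1) ∧ Valued.v (((((((u * κ : unitaryGroupOfForm σ ((StdForm.antidiagonal 3).over K)) : GL (Fin 3) K))⁻¹ :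 GL (Fin 3) K) : Matrix (Fin 3) (Fin 3) K) * (((γ : GL (Fin 3) K) : Matrix (Fin 3) (Fin 3) K) - 1) * (((u * κ : unitaryGroupOfForm σ ((StdForm.antidiagonal 3).over K)) : GL (Fin 3) K) : Matrix (Fin 3) (Fin 3) K)) 2 0) ≤ Valued.v ϖ ^ (d₀ + 1)) := by
  obtain ⟨p, g, hvp, hdp, hpg, hgv, hlevg⟩ := exists_parent_grandparent_lev_of_root hσ hvσ hσϖ hϖ hres h2 hnorm hT hγ0 hroot hv hvr hfix hvR
  -- the child `(uκ)·N₁` is adjacent to `v`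
  have hadj : (latticeGraph σ ϖ ((StdForm.antidiagonal 3).over K)).Adj v (latticeGraphIso σ ϖ ((StdForm.antidiagonal 3).over K) (u * κ) ⟨latt (Matrix.diagonal ![(1 : K), 1, ϖ]), 2, isVertexLattice_two_N₁_of_neg hσϖ hϖ⟩) := by
    have h := (mem_neighborSet_latticeGraphIso_root_iff hσ hvσ hσϖ hϖ h2 u (latticeGraphIso σ ϖ ((StdForm.antidiagonal 3).over K) (u * κ) ⟨latt (Matrix.diagonal ![(1 : K), 1, ϖ]), 2, isVertexLattice_two_N₁_of_neg hσϖ hϖ⟩)).2 ⟨κ, hκ, rfl⟩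
    rw [SimpleGraph.mem_neighborSet] at h
    rw [hvu]; exact h
  -- uniqueness of the parent in the rooted tree: both `p` and `(uκ)N₁` are THE parent of `v`
  obtain ⟨P, hP1, hP5, -, -⟩ := exists_rooted_parent hT (⟨stdLattice K 3, 0, isSelfDualLattice_stdLattice_three_of_v hϖ⟩ : {M : Submodule 𝒪[K] (Fin 3 → K) // IsVertex σ ϖ ((StdForm.antidiagonal 3).over K) M})
  have huniq : ∀ w, (latticeGraph σ ϖ ((StdForm.antidiagonal 3).over K)).Adj v w →
      (latticeGraph σ ϖ ((StdForm.antidiagonal 3).over K)).dist ⟨stdLattice K 3, 0, isSelfDualLattice_stdLattice_three_of_v hϖ⟩ w + 1 = (latticeGraph σ ϖ ((StdForm.antidiagonal 3).over K)).dist ⟨stdLattice K 3, 0, isSelfDualLattice_stdLattice_three_of_v hϖ⟩ v → w = P v := by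
    intro w hw hdw
    by_contra hne
    have h := (hP5 v w hvr hw hne).1
    omega
  have hpc : p = latticeGraphIso σ ϖ ((StdForm.antidiagonal 3).over K) (u * κ) ⟨latt (Matrix.diagonal ![(1 : K), 1, ϖ]), 2, isVertexLattice_two_N₁_of_neg hσϖ hϖ⟩ := by
    rw [huniq p hvp hdp, huniq _ hadj htow]
  rw [hpc] at hpg
  exact (map_sub_one_far_le_scaleLattice_iff_eigenline_of_odd hvσ hσϖ hϖ hres h2 hodd u hvu hvR κ hκ hgv hpg).1 hlevg

/-! ## §4 The block neighbour `u·N₁` is an eigenline -/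

/-- **`κ = 1` IS AN EIGENLINE in an adapted block frame**: `M′ = M = ι(g₁, u′) − 1` has `M₁₀ = 0` and `M₂₀ = g₁,₁₀` with `|g₁,₁₀| < |ϖ|^d`. [cite: Rogawski1990, §4.8 Case (a) p. 53] [cite: Tits1979, §3.5] -/
theorem eigenline_one_of_block (hϖ : Valued.v ϖ = WithZero.exp (-1 : ℤ))
    (u γ : unitaryGroupOfForm σ ((StdForm.antidiagonal 3).over K)) (g₁ : GL (Fin 2) K) (u' : GL (Fin 1) K)
    (hγu : ((u⁻¹ * γ * u : unitaryGroupOfForm σ ((StdForm.antidiagonal 3).over K)) : GL (Fin 3) K) = endoGL (g₁, u')) {d : ℕ}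
    (hadapt : Valued.v ((ϖ ^ d)⁻¹ * (g₁ : Matrix (Fin 2) (Fin 2) K) 1 0) < 1) :
    (Valued.v (((((((u * 1 : unitaryGroupOfForm σ ((StdForm.antidiagonal 3).over K)) : GL (Fin 3) K))⁻¹ : GL (Fin 3) K) : Matrix (Fin 3) (Fin 3) K) * (((γ : GL (Fin 3) K) : Matrix (Fin 3) (Fin 3) K) - 1) * (((u * 1 : unitaryGroupOfForm σ ((StdForm.antidiagonal 3).over K)) : GL (Fin 3) K) : Matrix (Fin 3) (Fin 3) K)) 1 0) ≤ Valued.v ϖ ^ (d + 1) ∧ Valued.v (((((((u * 1 : unitaryGroupOfForm σ ((StdForm.antidiagonal 3).over K)) : GL (Fin 3) K))⁻¹ : GL (Fin 3) K) : Matrix (Fin 3) (Fin 3) K) * (((γ : GL (Fin 3) K) : Matrix (Fin 3) (Fin 3) K) - 1) * (((u * 1 : unitaryGroupOfForm σ ((StdForm.antidiagonal 3).over K)) : GL (Fin 3) K) : Matrix (Fin 3) (Fin 3) K)) 2 0) ≤ Valued.v ϖ ^ (d + 1)) := by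
  rw [coe_conj_mul_sub_one_eq u γ 1, Subgroup.coe_one, inv_one, Units.val_one, Matrix.one_mul, Matrix.mul_one, hγu, coe_endoGL_sub_one_eq_endoShape]
  refine ⟨?_, ?_⟩
  · simp
  · have h := (v_inv_pow_mul_lt_one_iff hϖ d _).1 hadapt
    have e : (((g₁ : Matrix (Fin 2) (Fin 2) K)) - 1) 1 0 = (g₁ : Matrix (Fin 2) (Fin 2) K) 1 0 := by
      rw [Matrix.sub_apply, Matrix.one_apply_ne (by decide), sub_zero]
    simpa [e] using h

/-! ## §5 At a SHELL vertex an eigenline child is the block neighbour `u·N₁` -/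

omit [Valued K ℤᵐ⁰] in
/-- The block matrix `M = ι(g₁,u′) − 1` applied to a vector: components `0` and `2`. [cite: Rogawski1990, §4.8 Case (a) p. 53] -/
theorem endoGL_sub_one_mulVec_apply (g₁ : GL (Fin 2) K) (u' : GL (Fin 1) K) (x : Fin 3 → K) :
    ((((endoGL (g₁, u') : GL (Fin 3) K) : Matrix (Fin 3) (Fin 3) K) - 1) *ᵥ x) 0 = ((g₁ : Matrix (Fin 2) (Fin 2) K) - 1) 0 0 * x 0 + ((g₁ : Matrix (Fin 2) (Fin 2) K) - 1) 0 1 * x 2 ∧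
    ((((endoGL (g₁, u') : GL (Fin 3) K) : Matrix (Fin 3) (Fin 3) K) - 1) *ᵥ x) 1 = ((u' : Matrix (Fin 1) (Fin 1) K) 0 0 - 1) * x 1 ∧
    ((((endoGL (g₁, u') : GL (Fin 3) K) : Matrix (Fin 3) (Fin 3) K) - 1) *ᵥ x) 2 = ((g₁ : Matrix (Fin 2) (Fin 2) K) - 1) 1 0 * x 0 + ((g₁ : Matrix (Fin 2) (Fin 2) K) - 1) 1 1 * x 2 := by
  rw [coe_endoGL_sub_one_eq_endoShape]
  refine ⟨?_, ?_, ?_⟩ <;> simp [Matrix.mulVec, dotProduct, Fin.sum_univ_three]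

/-- **AT A SHELL VERTEX AN EIGENLINE CHILD IS `u·N₁`.**  Adapted block frame `↑(u⁻¹γu) = ι(g₁,u′)` at level `d` with `|g₁,₁₀| ≤ |ϖ|^(d+1)` (adapted),
`|(g₁−1)₀₀ − (g₁−1)₁₁| ≤ |ϖ|^(d+1)` (J-symmetric) and `¬ |g₁,₀₁| ≤ |ϖ|^(d+1)` (SHELL: the corner `l` is a unit at scale `ϖ^d`): if the child `(uκ)·N₁` (`κ ∈ K₀`) is an
eigenline then `|κ₂₀| < 1`, i.e. `(uκ)·N₁ = u·N₁` (★ `mapGL_N₁_eq_iff_v_apply_two_zero_lt_one`).  From `Mx ≡ cx` (§1), `x = κe₀`: if `|x₂| = 1` the `2`-component gives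
`c ≡ (g₁−1)₁₁`, then the `0`-component gives `|g₁,₀₁·x₂| ≤ |ϖ|^(d+1)`, contradiction. [cite: Kottwitz1986, §3] [cite: Rogawski1990, §4.9 Prop. 4.9.1 (b) p. 55] -/
theorem latticeGraphIso_eq_of_eigenline_of_shell (hvσ : ∀ a, Valued.v (σ a) = Valued.v a) (hσϖ : σ ϖ = -ϖ) (hϖ : Valued.v ϖ = WithZero.exp (-1 : ℤ))
    (u γ : unitaryGroupOfForm σ ((StdForm.antidiagonal 3).over K)) (g₁ : GL (Fin 2) K) (u' : GL (Fin 1) K)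
    (hγu : ((u⁻¹ * γ * u : unitaryGroupOfForm σ ((StdForm.antidiagonal 3).over K)) : GL (Fin 3) K) = endoGL (g₁, u')) {d : ℕ}
    (hadapt : Valued.v ((g₁ : Matrix (Fin 2) (Fin 2) K) 1 0) ≤ Valued.v ϖ ^ (d + 1))
    (hsym : Valued.v (((g₁ : Matrix (Fin 2) (Fin 2) K) - 1) 0 0 - ((g₁ : Matrix (Fin 2) (Fin 2) K) - 1) 1 1) ≤ Valued.v ϖ ^ (d + 1))
    (hshell : ¬ Valued.v ((g₁ : Matrix (Fin 2) (Fin 2) K) 0 1) ≤ Valued.v ϖ ^ (d + 1))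
    {κ : unitaryGroupOfForm σ ((StdForm.antidiagonal 3).over K)} (hκ : κ ∈ unitaryInt σ ((StdForm.antidiagonal 3).over K))
    (hEIG : (Valued.v (((((((u * κ : unitaryGroupOfForm σ ((StdForm.antidiagonal 3).over K)) : GL (Fin 3) K))⁻¹ : GL (Fin 3) K) : Matrix (Fin 3) (Fin 3) K) * (((γ : GL (Fin 3) K) : Matrix (Fin 3) (Fin 3) K) - 1) * (((u * κ : unitaryGroupOfForm σ ((StdForm.antidiagonal 3).over K)) : GL (Fin 3) K) : Matrix (Fin 3) (Fin 3) K)) 1 0) ≤ Valued.v ϖ ^ (d + 1) ∧ Valued.v (((((((u * κ : unitaryGroupOfForm σ ((StdForm.antidiagonal 3).over K)) : GL (Fin 3) K))⁻¹ : GL (Fin 3) K) : Matrix (Fin 3) (Fin 3) K) * (((γ : GL (Fin 3) K) : Matrix (Fin 3) (Fin 3) K) - 1) * (((u * κ : unitaryGroupOfForm σ ((StdForm.antidiagonal 3).over K)) : GL (Fin 3) K) : Matrix (Fin 3) (Fin 3) K)) 2 0) ≤ Valued.v ϖ ^ (d + 1))) :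
    latticeGraphIso σ ϖ ((StdForm.antidiagonal 3).over K) (u * κ) ⟨latt (Matrix.diagonal ![(1 : K), 1, ϖ]), 2, isVertexLattice_two_N₁_of_neg hσϖ hϖ⟩ = latticeGraphIso σ ϖ ((StdForm.antidiagonal 3).over K) (u * 1) ⟨latt (Matrix.diagonal ![(1 : K), 1, ϖ]), 2, isVertexLattice_two_N₁_of_neg hσϖ hϖ⟩ := by
  have hϖ1 : Valued.v ϖ ≤ 1 := by rw [hϖ, ← WithZero.exp_zero]; exact WithZero.exp_le_exp.2 (by norm_num)
  have hκi := (mem_unitaryInt_iff.1 hκ).1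
  obtain ⟨c, hc⟩ := (eigenline_iff_exists_congr u γ hκ d).1 hEIG
  obtain ⟨e0, -, e2⟩ := endoGL_sub_one_mulVec_apply g₁ u' (((κ : GL (Fin 3) K) : Matrix (Fin 3) (Fin 3) K) *ᵥ Pi.single 0 1)
  -- the entries of `x = κe₀`
  have hxi : ∀ i, (((κ : GL (Fin 3) K) : Matrix (Fin 3) (Fin 3) K) *ᵥ Pi.single 0 1) i = ((κ : GL (Fin 3) K) : Matrix (Fin 3) (Fin 3) K) i 0 := fun i => by rw [Matrix.mulVec_single_one]; rfl
  have hx0 : Valued.v ((((κ : GL (Fin 3) K) : Matrix (Fin 3) (Fin 3) K) *ᵥ Pi.single 0 1) 0) ≤ 1 := by rw [hxi]; exact hκi 0 0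
  -- suppose `|x₂| = 1`
  have hx2 : Valued.v ((((κ : GL (Fin 3) K) : Matrix (Fin 3) (Fin 3) K) *ᵥ Pi.single 0 1) 2) < 1 := by
    by_contra hge
    have hx2 : Valued.v ((((κ : GL (Fin 3) K) : Matrix (Fin 3) (Fin 3) K) *ᵥ Pi.single 0 1) 2) = 1 := le_antisymm (by rw [hxi]; exact hκi 2 0) (not_lt.1 hge)
    have h2 := hc 2
    have h0 := hc 0
    rw [hγu] at h2 h0
    rw [e2] at h2
    rw [e0] at h0
    -- `2`-component: `|((g₁−1)₁₁ − c)·x₂| ≤ |ϖ|^(d+1)`, hence `|(g₁−1)₁₁ − c| ≤ |ϖ|^(d+1)`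
    have h10 : Valued.v (((g₁ : Matrix (Fin 2) (Fin 2) K) - 1) 1 0) ≤ Valued.v ϖ ^ (d + 1) := by
      rw [Matrix.sub_apply, Matrix.one_apply_ne (by decide), sub_zero]; exact hadapt
    have hc2 : Valued.v (((g₁ : Matrix (Fin 2) (Fin 2) K) - 1) 1 1 - c) ≤ Valued.v ϖ ^ (d + 1) := by
      have e : ((g₁ : Matrix (Fin 2) (Fin 2) K) - 1) 1 1 - c = ((((g₁ : Matrix (Fin 2) (Fin 2) K) - 1) 1 0 * (((κ : GL (Fin 3) K) : Matrix (Fin 3) (Fin 3) K) *ᵥ Pi.single 0 1) 0 + ((g₁ : Matrix (Fin 2) (Fin 2) K) - 1) 1 1 * (((κ : GL (Fin 3) K) : Matrix (Fin 3) (Fin 3) K) *ᵥ Pi.single 0 1) 2 - c * (((κ : GL (Fin 3) K) : Matrix (Fin 3) (Fin 3) K) *ᵥ Pi.single 0 1) 2) - ((g₁ : Matrix (Fin 2) (Fin 2) K) - 1) 1 0 * (((κ : GL (Fin 3) K) : Matrix (Fin 3) (Fin 3) K) *ᵥ Pi.single 0 1) 0) * ((((κ : GL (Fin 3) K) : Matrix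 (Fin 3) (Fin 3) K) *ᵥ Pi.single 0 1) 2)⁻¹ := by
        have hx20 : (((κ : GL (Fin 3) K) : Matrix (Fin 3) (Fin 3) K) *ᵥ Pi.single 0 1) 2 ≠ 0 := fun h0 => by rw [h0, map_zero] at hx2; exact zero_ne_one hx2
        field_simp
        ring
      rw [e, map_mul, map_inv₀, hx2, inv_one, mul_one]
      refine (Valuation.map_sub _ _ _).trans (max_le h2 ?_)
      rw [map_mul]
      calc Valued.v (((g₁ : Matrix (Fin 2) (Fin 2) K) - 1) 1 0) * Valued.v ((((κ : GL (Fin 3) K) : Matrix (Fin 3) (Fin 3) K) *ᵥ Pi.single 0 1) 0) ≤ Valued.v ϖ ^ (d + 1) * 1 := mul_le_mul' h10 hx0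
        _ = Valued.v ϖ ^ (d + 1) := mul_one _
    -- `0`-component: `|((g₁−1)₀₀ − c)·x₀ + (g₁−1)₀₁·x₂| ≤ |ϖ|^(d+1)` with `|(g₁−1)₀₀ − c| ≤ |ϖ|^(d+1)`
    have hc0 : Valued.v (((g₁ : Matrix (Fin 2) (Fin 2) K) - 1) 0 0 - c) ≤ Valued.v ϖ ^ (d + 1) := by
      have e : ((g₁ : Matrix (Fin 2) (Fin 2) K) - 1) 0 0 - c = (((g₁ : Matrix (Fin 2) (Fin 2) K) - 1) 0 0 - ((g₁ : Matrix (Fin 2) (Fin 2) K) - 1) 1 1) + (((g₁ : Matrix (Fin 2) (Fin 2) K) - 1) 1 1 - c) := by ring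
      rw [e]; exact (Valuation.map_add _ _ _).trans (max_le hsym hc2)
    have h01 : Valued.v (((g₁ : Matrix (Fin 2) (Fin 2) K) - 1) 0 1 * (((κ : GL (Fin 3) K) : Matrix (Fin 3) (Fin 3) K) *ᵥ Pi.single 0 1) 2) ≤ Valued.v ϖ ^ (d + 1) := by
      have e : ((g₁ : Matrix (Fin 2) (Fin 2) K) - 1) 0 1 * (((κ : GL (Fin 3) K) : Matrix (Fin 3) (Fin 3) K) *ᵥ Pi.single 0 1) 2 = (((g₁ : Matrix (Fin 2) (Fin 2) K) - 1) 0 0 * (((κ : GL (Fin 3) K) : Matrix (Fin 3) (Fin 3) K) *ᵥ Pi.single 0 1) 0 + ((g₁ : Matrix (Fin 2) (Fin 2) K) - 1) 0 1 * (((κ : GL (Fin 3) K) : Matrix (Fin 3) (Fin 3) K) *ᵥ Pi.single 0 1) 2 - c * (((κ : GL (Fin 3) K) : Matrix (Fin 3) (Fin 3) K) *ᵥ Pi.single 0 1) 0) - (((g₁ : Matrix (Fin 2) (Fin 2) K) - 1) 0 0 - c) * (((κ : GL (Fin 3) K) : Matrix (Fin 3) (Fin 3) K) *ᵥ Pi.single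 0 1) 0 := by ring
      rw [e]
      refine (Valuation.map_sub _ _ _).trans (max_le h0 ?_)
      rw [map_mul]
      calc Valued.v (((g₁ : Matrix (Fin 2) (Fin 2) K) - 1) 0 0 - c) * Valued.v ((((κ : GL (Fin 3) K) : Matrix (Fin 3) (Fin 3) K) *ᵥ Pi.single 0 1) 0) ≤ Valued.v ϖ ^ (d + 1) * 1 := mul_le_mul' hc0 hx0
        _ = Valued.v ϖ ^ (d + 1) := mul_one _
    rw [map_mul, hx2, mul_one, Matrix.sub_apply, Matrix.one_apply_ne (by decide), sub_zero] at h01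
    exact hshell h01
  -- `|κ₂₀| < 1` ⇒ `κ·N₁ = N₁`
  rw [hxi] at hx2
  have hfixN : latticeGraphIso σ ϖ ((StdForm.antidiagonal 3).over K) κ ⟨latt (Matrix.diagonal ![(1 : K), 1, ϖ]), 2, isVertexLattice_two_N₁_of_neg hσϖ hϖ⟩ = ⟨latt (Matrix.diagonal ![(1 : K), 1, ϖ]), 2, isVertexLattice_two_N₁_of_neg hσϖ hϖ⟩ :=
    Subtype.ext (by rw [latticeGraphIso_apply_val]; exact (mapGL_N₁_eq_iff_v_apply_two_zero_lt_one hvσ hϖ hκ).2 hx2)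
  rw [latticeGraphIso_mul_apply, hfixN, mul_one]

/-! ## §6 At an INNER vertex a null child is an eigenline -/

/-- **AT AN INNER VERTEX A NULL CHILD IS AN EIGENLINE.**  Adapted block frame at level `d` with `|g₁,₁₀| ≤ |ϖ|^(d+1)`, J-symmetric, INNER (`|g₁,₀₁| ≤ |ϖ|^(d+1)`) and
`c̄ ≠ 0` (`¬ |ϖ^{−d}(u′₀₀ − g₁,₀₀)| < 1`): then `Mx = (g₁−1)₀₀·x + (u′₀₀ − g₁,₀₀)x₁·e₁ + O(ϖ^(d+1))` and `B₀(x, Mx) ≡ (u′₀₀ − g₁,₀₀)·σ(x₁)x₁` (`B₀(x,x) = 0`), so a NULL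
value forces `|x₁| < 1`, whence `Mx ≡ (g₁−1)₀₀·x (mod ϖ^(d+1))`: an eigenline (§1). [cite: Kottwitz1986, §3] [cite: Rogawski1990, §4.9 Prop. 4.9.1 (b) p. 55] -/
theorem eigenline_of_null_of_inner (hvσ : ∀ a, Valued.v (σ a) = Valued.v a) (hϖ : Valued.v ϖ = WithZero.exp (-1 : ℤ))
    (u γ : unitaryGroupOfForm σ ((StdForm.antidiagonal 3).over K)) (g₁ : GL (Fin 2) K) (u' : GL (Fin 1) K)
    (hγu : ((u⁻¹ * γ * u : unitaryGroupOfForm σ ((StdForm.antidiagonal 3).over K)) : GL (Fin 3) K) = endoGL (g₁, u')) {d : ℕ}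
    (hdeep : ∀ i j, Valued.v (((((u⁻¹ * γ * u : unitaryGroupOfForm σ ((StdForm.antidiagonal 3).over K)) : GL (Fin 3) K) : Matrix (Fin 3) (Fin 3) K) - 1) i j) ≤ Valued.v ϖ ^ d)
    (hadapt : Valued.v ((g₁ : Matrix (Fin 2) (Fin 2) K) 1 0) ≤ Valued.v ϖ ^ (d + 1))
    (hsym : Valued.v (((g₁ : Matrix (Fin 2) (Fin 2) K) - 1) 0 0 - ((g₁ : Matrix (Fin 2) (Fin 2) K) - 1) 1 1) ≤ Valued.v ϖ ^ (d + 1))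
    (hinner : Valued.v ((g₁ : Matrix (Fin 2) (Fin 2) K) 0 1) ≤ Valued.v ϖ ^ (d + 1))
    (hc : ¬ Valued.v ((ϖ ^ d)⁻¹ * ((u' : Matrix (Fin 1) (Fin 1) K) 0 0 - (g₁ : Matrix (Fin 2) (Fin 2) K) 0 0)) < 1)
    {κ : unitaryGroupOfForm σ ((StdForm.antidiagonal 3).over K)} (hκ : κ ∈ unitaryInt σ ((StdForm.antidiagonal 3).over K))
    (hnull : Valued.v ((ϖ ^ d)⁻¹ * pairing σ ((StdForm.antidiagonal 3).over K) (((κ : GL (Fin 3) K) : Matrix (Fin 3) (Fin 3) K) *ᵥ Pi.single 0 1) (((((u⁻¹ * γ * u : unitaryGroupOfForm σ ((StdForm.antidiagonal 3).over K)) : GL (Fin 3) K) : Matrix (Fin 3) (Fin 3) K) - 1) *ᵥ (((κ : GL (Fin 3) K) : Matrix (Fin 3) (Fin 3) K) *ᵥ Pi.single 0 1))) < 1) :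
    (Valued.v (((((((u * κ : unitaryGroupOfForm σ ((StdForm.antidiagonal 3).over K)) : GL (Fin 3) K))⁻¹ : GL (Fin 3) K) : Matrix (Fin 3) (Fin 3) K) * (((γ : GL (Fin 3) K) : Matrix (Fin 3) (Fin 3) K) - 1) * (((u * κ : unitaryGroupOfForm σ ((StdForm.antidiagonal 3).over K)) : GL (Fin 3) K) : Matrix (Fin 3) (Fin 3) K)) 1 0) ≤ Valued.v ϖ ^ (d + 1) ∧ Valued.v (((((((u * κ : unitaryGroupOfForm σ ((StdForm.antidiagonal 3).over K)) : GL (Fin 3) K))⁻¹ : GL (Fin 3) K) : Matrix (Fin 3) (Fin 3) K) * (((γ : GL (Fin 3) K) : Matrix (Fin 3) (Fin 3) K) - 1) * (((u * κ : unitaryGroupOfForm σ ((StdForm.antidiagonal 3).over K)) : GL (Fin 3) K) : Matrix (Fin 3) (Fin 3) K)) 2 0) ≤ Valued.v ϖ ^ (d + 1)) := by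
  have hϖ1 : Valued.v ϖ ≤ 1 := by rw [hϖ, ← WithZero.exp_zero]; exact WithZero.exp_le_exp.2 (by norm_num)
  have hκi := (mem_unitaryInt_iff.1 hκ).1
  obtain ⟨hxint, hxiso, -⟩ := firstColumn_props hκ
  have hxi : ∀ i, (((κ : GL (Fin 3) K) : Matrix (Fin 3) (Fin 3) K) *ᵥ Pi.single 0 1) i = ((κ : GL (Fin 3) K) : Matrix (Fin 3) (Fin 3) K) i 0 := fun i => by rw [Matrix.mulVec_single_one]; rfl
  have hxle : ∀ i, Valued.v ((((κ : GL (Fin 3) K) : Matrix (Fin 3) (Fin 3) K) *ᵥ Pi.single 0 1) i) ≤ 1 := fun i => by rw [hxi]; exact hκi i 0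
  obtain ⟨e0, e1, e2⟩ := endoGL_sub_one_mulVec_apply g₁ u' (((κ : GL (Fin 3) K) : Matrix (Fin 3) (Fin 3) K) *ᵥ Pi.single 0 1)
  have h10 : Valued.v (((g₁ : Matrix (Fin 2) (Fin 2) K) - 1) 1 0) ≤ Valued.v ϖ ^ (d + 1) := by
    rw [Matrix.sub_apply, Matrix.one_apply_ne (by decide), sub_zero]; exact hadapt
  have h01 : Valued.v (((g₁ : Matrix (Fin 2) (Fin 2) K) - 1) 0 1) ≤ Valued.v ϖ ^ (d + 1) := by
    rw [Matrix.sub_apply, Matrix.one_apply_ne (by decide), sub_zero]; exact hinner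
  -- the remainder `r := Mx − (g₁−1)₀₀·x`: components `0, 2` are `ϖ^(d+1)`-small, component `1` is `(u′₀₀ − g₁,₀₀)·x₁`
  have hr0 : Valued.v ((((((u⁻¹ * γ * u : unitaryGroupOfForm σ ((StdForm.antidiagonal 3).over K)) : GL (Fin 3) K) : Matrix (Fin 3) (Fin 3) K) - 1) *ᵥ (((κ : GL (Fin 3) K) : Matrix (Fin 3) (Fin 3) K) *ᵥ Pi.single 0 1)) 0 - ((g₁ : Matrix (Fin 2) (Fin 2) K) - 1) 0 0 * (((κ : GL (Fin 3) K) : Matrix (Fin 3) (Fin 3) K) *ᵥ Pi.single 0 1) 0) ≤ Valued.v ϖ ^ (d + 1) := by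
    rw [hγu, e0, show ((g₁ : Matrix (Fin 2) (Fin 2) K) - 1) 0 0 * (((κ : GL (Fin 3) K) : Matrix (Fin 3) (Fin 3) K) *ᵥ Pi.single 0 1) 0 + ((g₁ : Matrix (Fin 2) (Fin 2) K) - 1) 0 1 * (((κ : GL (Fin 3) K) : Matrix (Fin 3) (Fin 3) K) *ᵥ Pi.single 0 1) 2 - ((g₁ : Matrix (Fin 2) (Fin 2) K) - 1) 0 0 * (((κ : GL (Fin 3) K) : Matrix (Fin 3) (Fin 3) K) *ᵥ Pi.single 0 1) 0 = ((g₁ : Matrix (Fin 2) (Fin 2) K) - 1) 0 1 * (((κ : GL (Fin 3) K) : Matrix (Fin 3) (Fin 3) K) *ᵥ Pi.single 0 1) 2 by ring, map_mul]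
    calc Valued.v (((g₁ : Matrix (Fin 2) (Fin 2) K) - 1) 0 1) * Valued.v ((((κ : GL (Fin 3) K) : Matrix (Fin 3) (Fin 3) K) *ᵥ Pi.single 0 1) 2) ≤ Valued.v ϖ ^ (d + 1) * 1 := mul_le_mul' h01 (hxle 2)
      _ = _ := mul_one _
  have hr2 : Valued.v ((((((u⁻¹ * γ * u : unitaryGroupOfForm σ ((StdForm.antidiagonal 3).over K)) : GL (Fin 3) K) : Matrix (Fin 3) (Fin 3) K) - 1) *ᵥ (((κ : GL (Fin 3) K) : Matrix (Fin 3) (Fin 3) K) *ᵥ Pi.single 0 1)) 2 - ((g₁ : Matrix (Fin 2) (Fin 2) K) - 1) 0 0 * (((κ : GL (Fin 3) K) : Matrix (Fin 3) (Fin 3) K) *ᵥ Pi.single 0 1) 2) ≤ Valued.v ϖ ^ (d + 1) := by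
    rw [hγu, e2, show ((g₁ : Matrix (Fin 2) (Fin 2) K) - 1) 1 0 * (((κ : GL (Fin 3) K) : Matrix (Fin 3) (Fin 3) K) *ᵥ Pi.single 0 1) 0 + ((g₁ : Matrix (Fin 2) (Fin 2) K) - 1) 1 1 * (((κ : GL (Fin 3) K) : Matrix (Fin 3) (Fin 3) K) *ᵥ Pi.single 0 1) 2 - ((g₁ : Matrix (Fin 2) (Fin 2) K) - 1) 0 0 * (((κ : GL (Fin 3) K) : Matrix (Fin 3) (Fin 3) K) *ᵥ Pi.single 0 1) 2 = ((g₁ : Matrix (Fin 2) (Fin 2) K) - 1) 1 0 * (((κ : GL (Fin 3) K) : Matrix (Fin 3) (Fin 3) K) *ᵥ Pi.single 0 1) 0 - (((g₁ : Matrix (Fin 2) (Fin 2) K) - 1) 0 0 - ((g₁ : Matrix (Fin 2) (Fin 2) K) - 1) 1 1) * (((κ : GL (Fin 3) K) : Matrix (Fin 3) (Fin 3) K) *ᵥ Pi.single 0 1) 2 by ring]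
    refine (Valuation.map_sub _ _ _).trans (max_le ?_ ?_) <;> rw [map_mul]
    · calc Valued.v (((g₁ : Matrix (Fin 2) (Fin 2) K) - 1) 1 0) * Valued.v ((((κ : GL (Fin 3) K) : Matrix (Fin 3) (Fin 3) K) *ᵥ Pi.single 0 1) 0) ≤ Valued.v ϖ ^ (d + 1) * 1 := mul_le_mul' h10 (hxle 0)
        _ = _ := mul_one _
    · calc Valued.v (((g₁ : Matrix (Fin 2) (Fin 2) K) - 1) 0 0 - ((g₁ : Matrix (Fin 2) (Fin 2) K) - 1) 1 1) * Valued.v ((((κ : GL (Fin 3) K) : Matrix (Fin 3) (Fin 3) K) *ᵥ Pi.single 0 1) 2) ≤ Valued.v ϖ ^ (d + 1) * 1 := mul_le_mul' hsym (hxle 2)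
        _ = _ := mul_one _
  have hr1 : (((((u⁻¹ * γ * u : unitaryGroupOfForm σ ((StdForm.antidiagonal 3).over K)) : GL (Fin 3) K) : Matrix (Fin 3) (Fin 3) K) - 1) *ᵥ (((κ : GL (Fin 3) K) : Matrix (Fin 3) (Fin 3) K) *ᵥ Pi.single 0 1)) 1 - ((g₁ : Matrix (Fin 2) (Fin 2) K) - 1) 0 0 * (((κ : GL (Fin 3) K) : Matrix (Fin 3) (Fin 3) K) *ᵥ Pi.single 0 1) 1 = (((u' : Matrix (Fin 1) (Fin 1) K) 0 0) - (g₁ : Matrix (Fin 2) (Fin 2) K) 0 0) * (((κ : GL (Fin 3) K) : Matrix (Fin 3) (Fin 3) K) *ᵥ Pi.single 0 1) 1 := by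
    rw [hγu, e1, Matrix.sub_apply, Matrix.one_apply_eq]; ring
  -- the value: `B₀(x, Mx) = B₀(x, r) + (g₁−1)₀₀·B₀(x, x)`, `B₀(x,x) = 0`
  have hval : pairing σ ((StdForm.antidiagonal 3).over K) (((κ : GL (Fin 3) K) : Matrix (Fin 3) (Fin 3) K) *ᵥ Pi.single 0 1) (((((u⁻¹ * γ * u : unitaryGroupOfForm σ ((StdForm.antidiagonal 3).over K)) : GL (Fin 3) K) : Matrix (Fin 3) (Fin 3) K) - 1) *ᵥ (((κ : GL (Fin 3) K) : Matrix (Fin 3) (Fin 3) K) *ᵥ Pi.single 0 1)) - σ ((((κ : GL (Fin 3) K) : Matrix (Fin 3) (Fin 3) K) *ᵥ Pi.single 0 1) 1) * ((((u' : Matrix (Fin 1) (Fin 1) K) 0 0) - (g₁ : Matrix (Fin 2) (Fin 2) K) 0 0) * (((κ : GL (Fin 3) K) : Matrix (Fin 3) (Fin 3) K) *ᵥ Pi.single 0 1) 1) =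
      σ ((((κ : GL (Fin 3) K) : Matrix (Fin 3) (Fin 3) K) *ᵥ Pi.single 0 1) 0) * ((((((u⁻¹ * γ * u : unitaryGroupOfForm σ ((StdForm.antidiagonal 3).over K)) : GL (Fin 3) K) : Matrix (Fin 3) (Fin 3) K) - 1) *ᵥ (((κ : GL (Fin 3) K) : Matrix (Fin 3) (Fin 3) K) *ᵥ Pi.single 0 1)) 2 - ((g₁ : Matrix (Fin 2) (Fin 2) K) - 1) 0 0 * (((κ : GL (Fin 3) K) : Matrix (Fin 3) (Fin 3) K) *ᵥ Pi.single 0 1) 2) + σ ((((κ : GL (Fin 3) K) : Matrix (Fin 3) (Fin 3) K) *ᵥ Pi.single 0 1) 2) * ((((((u⁻¹ * γ * u : unitaryGroupOfForm σ ((StdForm.antidiagonal 3).over K)) : GL (Fin 3) K) : Matrix (Fin 3) (Fin 3) K) - 1) *ᵥ (((κ : GL (Fin 3) K) : Matrix (Fin 3) (Fin 3) K) *ᵥ Pi.single 0 1)) 0 - ((g₁ : Matrix (Fin 2) (Fin 2) K) - 1) 0 0 * (((κ : GL (Fin 3) K) : Matrix (Fin 3) (Fin 3) K) *ᵥ Pi.single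 0 1) 0) +
        ((g₁ : Matrix (Fin 2) (Fin 2) K) - 1) 0 0 * B₀ σ 3 (((κ : GL (Fin 3) K) : Matrix (Fin 3) (Fin 3) K) *ᵥ Pi.single 0 1) (((κ : GL (Fin 3) K) : Matrix (Fin 3) (Fin 3) K) *ᵥ Pi.single 0 1) := by
    rw [← hr1, pairing_antidiagonal, B₀_apply, B₀_apply, Fin.sum_univ_three, Fin.sum_univ_three,
      show Fin.rev (0 : Fin 3) = 2 from rfl, show Fin.rev (1 : Fin 3) = 1 from rfl, show Fin.rev (2 : Fin 3) = 0 from rfl]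
    ring
  rw [hxiso, mul_zero, add_zero] at hval
  have hvalle : Valued.v (pairing σ ((StdForm.antidiagonal 3).over K) (((κ : GL (Fin 3) K) : Matrix (Fin 3) (Fin 3) K) *ᵥ Pi.single 0 1) (((((u⁻¹ * γ * u : unitaryGroupOfForm σ ((StdForm.antidiagonal 3).over K)) : GL (Fin 3) K) : Matrix (Fin 3) (Fin 3) K) - 1) *ᵥ (((κ : GL (Fin 3) K) : Matrix (Fin 3) (Fin 3) K) *ᵥ Pi.single 0 1)) - σ ((((κ : GL (Fin 3) K) : Matrix (Fin 3) (Fin 3) K) *ᵥ Pi.single 0 1) 1) * ((((u' : Matrix (Fin 1) (Fin 1) K) 0 0) - (g₁ : Matrix (Fin 2) (Fin 2) K) 0 0) * (((κ : GL (Fin 3) K) : Matrix (Fin 3) (Fin 3) K) *ᵥ Pi.single 0 1) 1)) ≤ Valued.v ϖ ^ (d + 1) := by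
    rw [hval]
    refine (Valuation.map_add _ _ _).trans (max_le ?_ ?_) <;> rw [map_mul, hvσ]
    · calc Valued.v ((((κ : GL (Fin 3) K) : Matrix (Fin 3) (Fin 3) K) *ᵥ Pi.single 0 1) 0) * _ ≤ 1 * Valued.v ϖ ^ (d + 1) := mul_le_mul' (hxle 0) hr2
        _ = _ := one_mul _
    · calc Valued.v ((((κ : GL (Fin 3) K) : Matrix (Fin 3) (Fin 3) K) *ᵥ Pi.single 0 1) 2) * _ ≤ 1 * Valued.v ϖ ^ (d + 1) := mul_le_mul' (hxle 2) hr0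
        _ = _ := one_mul _
  -- null value ⇒ `|σ(x₁)(u′₀₀ − g₁,₀₀)x₁| ≤ |ϖ|^(d+1)` ⇒ `|x₁|² ≤ |ϖ|` ⇒ `|x₁| ≤ |ϖ|`
  have hnull' : Valued.v (pairing σ ((StdForm.antidiagonal 3).over K) (((κ : GL (Fin 3) K) : Matrix (Fin 3) (Fin 3) K) *ᵥ Pi.single 0 1) (((((u⁻¹ * γ * u : unitaryGroupOfForm σ ((StdForm.antidiagonal 3).over K)) : GL (Fin 3) K) : Matrix (Fin 3) (Fin 3) K) - 1) *ᵥ (((κ : GL (Fin 3) K) : Matrix (Fin 3) (Fin 3) K) *ᵥ Pi.single 0 1))) ≤ Valued.v ϖ ^ (d + 1) := (v_inv_pow_mul_lt_one_iff hϖ d _).1 hnull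
  have hprod : Valued.v (((((u' : Matrix (Fin 1) (Fin 1) K) 0 0) - (g₁ : Matrix (Fin 2) (Fin 2) K) 0 0)) * (σ ((((κ : GL (Fin 3) K) : Matrix (Fin 3) (Fin 3) K) *ᵥ Pi.single 0 1) 1) * (((κ : GL (Fin 3) K) : Matrix (Fin 3) (Fin 3) K) *ᵥ Pi.single 0 1) 1)) ≤ Valued.v ϖ ^ (d + 1) := by
    have e : ((((u' : Matrix (Fin 1) (Fin 1) K) 0 0) - (g₁ : Matrix (Fin 2) (Fin 2) K) 0 0)) * (σ ((((κ : GL (Fin 3) K) : Matrix (Fin 3) (Fin 3) K) *ᵥ Pi.single 0 1) 1) * (((κ : GL (Fin 3) K) : Matrix (Fin 3) (Fin 3) K) *ᵥ Pi.single 0 1) 1) =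
        pairing σ ((StdForm.antidiagonal 3).over K) (((κ : GL (Fin 3) K) : Matrix (Fin 3) (Fin 3) K) *ᵥ Pi.single 0 1) (((((u⁻¹ * γ * u : unitaryGroupOfForm σ ((StdForm.antidiagonal 3).over K)) : GL (Fin 3) K) : Matrix (Fin 3) (Fin 3) K) - 1) *ᵥ (((κ : GL (Fin 3) K) : Matrix (Fin 3) (Fin 3) K) *ᵥ Pi.single 0 1)) - (pairing σ ((StdForm.antidiagonal 3).over K) (((κ : GL (Fin 3) K) : Matrix (Fin 3) (Fin 3) K) *ᵥ Pi.single 0 1) (((((u⁻¹ * γ * u : unitaryGroupOfForm σ ((StdForm.antidiagonal 3).over K)) : GL (Fin 3) K) : Matrix (Fin 3) (Fin 3) K) - 1) *ᵥ (((κ : GL (Fin 3) K) : Matrix (Fin 3) (Fin 3) K) *ᵥ Pi.single 0 1)) - σ ((((κ : GL (Fin 3) K) : Matrix (Fin 3) (Fin 3) K) *ᵥ Pi.single 0 1) 1) * ((((u' : Matrix (Fin 1) (Fin 1) K) 0 0) - (g₁ : Matrix (Fin 2) (Fin 2) K) 0 0) * (((κ : GL (Fin 3) K) : Matrix (Fin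 3) (Fin 3) K) *ᵥ Pi.single 0 1) 1)) := by ring
    rw [e]; exact (Valuation.map_sub _ _ _).trans (max_le hnull' hvalle)
  have hx1sq : Valued.v (σ ((((κ : GL (Fin 3) K) : Matrix (Fin 3) (Fin 3) K) *ᵥ Pi.single 0 1) 1) * (((κ : GL (Fin 3) K) : Matrix (Fin 3) (Fin 3) K) *ᵥ Pi.single 0 1) 1) ≤ Valued.v ϖ := v_le_of_mul_le_of_not_lt hϖ hc hprod
  have hx1 : Valued.v ((((κ : GL (Fin 3) K) : Matrix (Fin 3) (Fin 3) K) *ᵥ Pi.single 0 1) 1) ≤ Valued.v ϖ := by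
    rw [map_mul, hvσ] at hx1sq
    by_contra hgt
    have h1 : Valued.v ((((κ : GL (Fin 3) K) : Matrix (Fin 3) (Fin 3) K) *ᵥ Pi.single 0 1) 1) = 1 :=
      le_antisymm (hxle 1) (not_lt.1 fun hlt => hgt (by rw [hϖ]; exact (v_lt_one_iff _).1 hlt))
    rw [h1, mul_one] at hx1sq
    have hϖlt1 : Valued.v ϖ < 1 := by rw [hϖ, ← WithZero.exp_zero]; exact WithZero.exp_lt_exp.2 (by norm_num)
    exact absurd hx1sq (not_le.2 hϖlt1)
  -- hence `Mx ≡ (g₁−1)₀₀·x (mod ϖ^(d+1))`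
  refine (eigenline_iff_exists_congr u γ hκ d).2 ⟨((g₁ : Matrix (Fin 2) (Fin 2) K) - 1) 0 0, fun i => ?_⟩
  fin_cases i
  · exact hr0
  · show Valued.v ((((((u⁻¹ * γ * u : unitaryGroupOfForm σ ((StdForm.antidiagonal 3).over K)) : GL (Fin 3) K) : Matrix (Fin 3) (Fin 3) K) - 1) *ᵥ (((κ : GL (Fin 3) K) : Matrix (Fin 3) (Fin 3) K) *ᵥ Pi.single 0 1)) 1 - ((g₁ : Matrix (Fin 2) (Fin 2) K) - 1) 0 0 * (((κ : GL (Fin 3) K) : Matrix (Fin 3) (Fin 3) K) *ᵥ Pi.single 0 1) 1) ≤ Valued.v ϖ ^ (d + 1)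
    rw [hr1]
    -- `|(u′₀₀ − g₁,₀₀)| ≤ |ϖ|^d` (both blocks are `d`-deep in the frame? only the product is needed): `|(u′₀₀ − g₁,₀₀)·x₁| ≤ |ϖ|^d·|ϖ|`
    have hcd : Valued.v (((u' : Matrix (Fin 1) (Fin 1) K) 0 0) - (g₁ : Matrix (Fin 2) (Fin 2) K) 0 0) ≤ Valued.v ϖ ^ d := by
      have hM11 := hdeep 1 1
      have hM00 := hdeep 0 0
      rw [hγu, coe_endoGL_sub_one_eq_endoShape] at hM11 hM00
      simp only [Matrix.of_apply, Matrix.cons_val', Matrix.cons_val_zero, Matrix.cons_val_one, Matrix.empty_val',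
        Matrix.cons_val_fin_one] at hM11 hM00
      have e : ((u' : Matrix (Fin 1) (Fin 1) K) 0 0) - (g₁ : Matrix (Fin 2) (Fin 2) K) 0 0 = (((u' : Matrix (Fin 1) (Fin 1) K) 0 0) - 1) - (((g₁ : Matrix (Fin 2) (Fin 2) K) - 1) 0 0) := by
        rw [Matrix.sub_apply, Matrix.one_apply_eq]; ring
      rw [e]
      exact (Valuation.map_sub _ _ _).trans (max_le hM11 hM00)
    rw [map_mul, pow_succ]
    exact mul_le_mul' hcd hx1
  · exact hr2

end Literature.NumberTheory.Rogawski1990.TypeOneRamifiedJunction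

end
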